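import Literature.Analysis.InnerProduct.SchurInequality
import Mathlib.Analysis.CStarAlgebra.Matrix
import Mathlib.Analysis.SpecialFunctions.Exp

/-!
# OutputRateGaussianVolume — the PER-VOLUME normalisation factor of a displaced complex Gaussian: for an `N × N` complex matrix `Y` with
# `‖Y‖ ≤ r < 1` (ℓ²-operator norm), `|det(1 + Y)| ≥ (1 − r)^N`, hence `|det(1 + Y)|⁻¹ ≤ (1 − r)^{−N} ≤ e^{N·r/(1−r)}`; and for an invertible
# base covariance `C₀` displaced to `C₀ + E` with `‖C₀⁻¹E‖ ≤ r`, `|det(C₀ + E)|⁻¹ ≤ |det C₀|⁻¹·(1 − r)^{−N}` (cell `pub-balaban`, T⁴ fan-out,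
# `HOME/BINDER-OWNERS.md` row NE5, owner lineage t4-ne5-p1, gen 28, route P1; record `t4/T4-EST-NE5-P1.md` §54.10)

HONEST FRAMING (T4-DAG PAGE 1).  Rung (B)+1 on ONE finite four-torus — NOT infinite volume, NOT a mass gap, NOT the Clay problem; `FlowStep.BetaPertH`,
(B), (B^μ) do not occur here.  NE5 is NOT PRINTED and NOT PROVED (spine 0/9).  This module is elementary linear algebra ([folklore]; eigenvalues of
`Y` are bounded by `‖Y‖`, `det(1 + Y) = Π(1 + λᵢ)` — the tree's `Literature.Analysis.InnerProduct.matrix_det_one_add_eq_prod_roots_charpoly`);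
nothing of Bałaban's series is asserted; 0 cite tags.  WHY IT IS HERE (the census of wall W2-op, record §54.10): in the (H-rep) dictionary of
`OutputRateOpHolomorphic` the Gaussian `dμ_{C^{(k)}(Z₀,σ)}(B)` of [II] (2.14) is a density `det(2πC)^{−1/2}·exp(−½⟨B, C⁻¹B⟩)` against Lebesgue
measure on the `N(Z₀) ∝ |Z₀|` bond variables; displacing the operators (σ onto Bałaban's complex circles — his step (2.15); the operator datum over
the complex ball of radius `rOp` — ours) changes the normalisation by `|det(1 + C₀⁻¹(C − C₀))|^{−1/2}`, and THIS module bounds that factor by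
`(1 − r)^{−N/2} ≤ e^{N·r/(2(1−r))}` — a PER-VOLUME factor of exactly the printed form `exp((…)|Z₀|)` of (2.17) p. 16, which [II] absorbs into
`α₅` ((2.25)) through (2.30) under the provisos «(LM)⁴α₄, … ≤ 1» (p. 20).  Census consequence: W2-op's margin letter must satisfy the VOLUME
condition `(LM)⁴·O(‖C₀⁻¹‖·m_C)·rOp ≤ 1` besides the pointwise margin `m₁·rOp < m₀` — met by choosing `rOp = O((LM)⁻⁴)`, at a CONSTANT-ONLY price in
W1's `δ`.  No wall is discharged from print; NE5 NOT PROVED; spine 0/9; NOT infinite volume / mass gap / Clay.  0 sorry; axioms ⊆ {propext,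
Classical.choice, Quot.sound}.
-/

noncomputable section

open scoped Matrix.Norms.L2Operator
open Matrix WithLp

namespace Summit.QuantumFields.BalabanUV.T4Continuum.OutputRateGaussianVolume

variable {n : Type*} [Fintype n] [DecidableEq n]

/-! ## §1 Eigenvalues are bounded by the ℓ²-operator norm -/

/-- `‖toLp 2 (Y v)‖ ≤ ‖Y‖·‖toLp 2 v‖` (Mathlib's `Matrix.l2_opNorm_mulVec` on `n → ℂ`; plumbing). [folklore] -/
theorem norm_toLp_mulVec_le (Y : Matrix n n ℂ) (v : n → ℂ) : ‖toLp 2 (Y *ᵥ v)‖ ≤ ‖Y‖ * ‖toLp 2 v‖ := by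
  simpa using Matrix.l2_opNorm_mulVec Y (toLp 2 v)

/-- **EVERY ROOT OF THE CHARACTERISTIC POLYNOMIAL IS BOUNDED BY THE OPERATOR NORM**: `χ_Y(y) = 0 ⟹ ‖y‖ ≤ ‖Y‖` (eigenvector `u ≠ 0`,
`‖y‖‖u‖ = ‖Yu‖ ≤ ‖Y‖‖u‖`). [folklore] -/
theorem norm_le_opNorm_of_isRoot_charpoly (Y : Matrix n n ℂ) {y : ℂ} (hy : Y.charpoly.IsRoot y) : ‖y‖ ≤ ‖Y‖ := by
  obtain ⟨u, hu0, hu⟩ := Literature.Analysis.InnerProduct.matrix_exists_mulVec_eq_smul_of_isRoot_charpoly Y hy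
  have hpos : 0 < ‖toLp 2 u‖ := by
    rw [norm_pos_iff]
    intro h
    apply hu0
    have : ofLp (toLp 2 u) = ofLp (0 : EuclideanSpace ℂ n) := by rw [h]
    simpa using this
  have h := norm_toLp_mulVec_le Y u
  rw [hu, WithLp.toLp_smul, norm_smul] at h
  exact le_of_mul_le_mul_right h hpos

/-! ## §2 The determinant of `1 + Y` is bounded below by `(1 − ‖Y‖)^N` -/

/-- Multiset form: if every element of `s` has norm `≤ r ≤ 1`, then `(1 − r)^{card s} ≤ ‖Π_{y ∈ s}(1 + y)‖`. [folklore] -/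
theorem pow_card_le_norm_prod_map_one_add {s : Multiset ℂ} {r : ℝ} (hr1 : r ≤ 1) (hs : ∀ y ∈ s, ‖y‖ ≤ r) :
    (1 - r) ^ Multiset.card s ≤ ‖(s.map fun y => 1 + y).prod‖ := by
  induction s using Multiset.induction_on with
  | empty => simp
  | cons a s ih =>
    rw [Multiset.map_cons, Multiset.prod_cons, norm_mul, Multiset.card_cons, pow_succ, mul_comm]
    have ha : 1 - r ≤ ‖1 + a‖ := by
      have h1 : ‖(1 : ℂ)‖ - ‖a‖ ≤ ‖1 + a‖ := by
        have := norm_sub_norm_le (1 + a) a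
        simp only [add_sub_cancel_right] at this
        linarith [norm_sub_le_norm_add (1 : ℂ) a, abs_norm_sub_norm_le (1 + a) a]
      rw [norm_one] at h1
      linarith [hs a (Multiset.mem_cons_self a s)]
    exact mul_le_mul ha (ih fun y hy => hs y (Multiset.mem_cons_of_mem hy)) (pow_nonneg (by linarith) _) (norm_nonneg _)

/-- **`(1 − r)^N ≤ |det(1 + Y)|` for `‖Y‖ ≤ r ≤ 1`** (`det(1 + Y) = Π(1 + λᵢ)` over the `N = card n` roots of `χ_Y`, each `|λᵢ| ≤ ‖Y‖ ≤ r`).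
[folklore] -/
theorem pow_le_norm_det_one_add (Y : Matrix n n ℂ) {r : ℝ} (hY : ‖Y‖ ≤ r) (hr1 : r ≤ 1) :
    (1 - r) ^ Fintype.card n ≤ ‖(1 + Y).det‖ := by
  rw [Literature.Analysis.InnerProduct.matrix_det_one_add_eq_prod_roots_charpoly Y]
  have hcard : Multiset.card Y.charpoly.roots = Fintype.card n := by
    rw [← (IsAlgClosed.splits Y.charpoly).natDegree_eq_card_roots, Matrix.charpoly_natDegree_eq_dim]
  rw [← hcard]
  exact pow_card_le_norm_prod_map_one_add hr1 fun y hy =>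
    (norm_le_opNorm_of_isRoot_charpoly Y ((Polynomial.mem_roots Y.charpoly_monic.ne_zero).1 hy)).trans hY

/-- Hence the INVERSE normalisation factor: `|det(1 + Y)|⁻¹ ≤ (1 − r)^{−N}` for `‖Y‖ ≤ r < 1` (in particular `det(1 + Y) ≠ 0`). [folklore] -/
theorem norm_inv_det_one_add_le (Y : Matrix n n ℂ) {r : ℝ} (hY : ‖Y‖ ≤ r) (hr1 : r < 1) :
    ‖((1 + Y).det)⁻¹‖ ≤ ((1 - r)⁻¹) ^ Fintype.card n := by
  have hpos : 0 < (1 - r) ^ Fintype.card n := pow_pos (by linarith) _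
  have h := pow_le_norm_det_one_add Y hY hr1.le
  rw [norm_inv, inv_pow]
  exact inv_anti₀ hpos h

/-- The exponential form of the per-volume factor: `(1 − r)^{−N} ≤ exp(N·r/(1 − r))` (`(1 − r)⁻¹ = 1 + r/(1 − r) ≤ e^{r/(1−r)}`) — the shape
`exp(const·|Z₀|)` of [II] (2.17). [folklore] -/
theorem inv_pow_le_exp {r : ℝ} (hr1 : r < 1) (N : ℕ) : ((1 - r)⁻¹) ^ N ≤ Real.exp (N * (r / (1 - r))) := by
  have h1r : 0 < 1 - r := by linarith
  have hbase : (1 - r)⁻¹ ≤ Real.exp (r / (1 - r)) := by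
    have heq : (1 - r)⁻¹ = r / (1 - r) + 1 := by field_simp; ring
    rw [heq]
    exact Real.add_one_le_exp _
  calc ((1 - r)⁻¹) ^ N ≤ (Real.exp (r / (1 - r))) ^ N :=
        pow_le_pow_left₀ (inv_nonneg.2 h1r.le) hbase N
    _ = Real.exp (N * (r / (1 - r))) := by rw [← Real.exp_nat_mul]

/-- **THE VOLUME FACTOR**: `‖Y‖ ≤ r < 1 ⟹ |det(1 + Y)|⁻¹ ≤ exp(N·r/(1 − r))`, `N = card n`. [folklore] -/
theorem norm_inv_det_one_add_le_exp (Y : Matrix n n ℂ) {r : ℝ} (hY : ‖Y‖ ≤ r) (hr1 : r < 1) :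
    ‖((1 + Y).det)⁻¹‖ ≤ Real.exp (Fintype.card n * (r / (1 - r))) :=
  (norm_inv_det_one_add_le Y hY hr1).trans (inv_pow_le_exp hr1 _)

/-! ## §3 Displacing an invertible base covariance -/

/-- **DISPLACED COVARIANCE**: for an invertible base matrix `C₀` (`IsUnit C₀.det`) and a displacement `E` with `‖C₀⁻¹E‖ ≤ r < 1`,
`|det(C₀ + E)|⁻¹ ≤ |det C₀|⁻¹ · (1 − r)^{−N}` — since `C₀ + E = C₀(1 + C₀⁻¹E)`.  Reading ((2.17) KIND): the Gaussian normalisation of the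
displaced complex covariance exceeds the base one by at most the per-volume factor. [folklore] -/
theorem norm_inv_det_add_le (C₀ E : Matrix n n ℂ) (hC₀ : IsUnit C₀.det) {r : ℝ} (hE : ‖C₀⁻¹ * E‖ ≤ r) (hr1 : r < 1) :
    ‖((C₀ + E).det)⁻¹‖ ≤ ‖(C₀.det)⁻¹‖ * ((1 - r)⁻¹) ^ Fintype.card n := by
  have hfac : C₀ + E = C₀ * (1 + C₀⁻¹ * E) := by
    rw [Matrix.mul_add, Matrix.mul_one, Matrix.mul_nonsing_inv_cancel_left _ _ hC₀]
  rw [hfac, Matrix.det_mul, mul_inv, norm_mul]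
  exact mul_le_mul_of_nonneg_left (norm_inv_det_one_add_le _ hE hr1) (norm_nonneg _)

end Summit.QuantumFields.BalabanUV.T4Continuum.OutputRateGaussianVolume

end
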